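import Summits.ResolutionOfSingularities.ResolutionOfSingularities.Theorems.PurelyInseparableDim4IsolationConverse
import Mathlib.LinearAlgebra.Basis.VectorSpace
import Mathlib.LinearAlgebra.Finsupp.LinearCombination
import HarnessLib
import HarnessLib.Audit.Tags

/-!
# Purely inseparable fourfolds — isolation goes DOWN: the Scope predicate `IsIsolated` is geometric
# [OURS · counted 0 · commutative algebra about OUR frame's isolation predicate, not about resolution]

Census cell «res-dim4-pi» (D-0157 DOOR 2), width seat `res-dim4-p-14`, brick PR-12g; sequel of PR-12f
(`PurelyInseparableDim4IsolationConverse`: isolation ⟺ certificate; isolation goes UP).  Here the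
certificate `𝔪₀ᴺ ≤ J_q⁺(F) + 𝔪₀ᴺ⁺¹` is DESCENDED along a homomorphism of fields `f : k →+* K`: a
`k`-linear retraction `φ : K → k` of `f` (vector spaces over a field, `LinearMap.exists_leftInverse_of_injective`),
applied coefficientwise (`AddMonoidAlgebra.map`), is additive, fixes `k[x]` and is `k[x]`-linear on
products `G · (H ⊗ K)` (`map_mul_map_eq`), so it carries a certificate row
`x^γ = Σ g_α · D^{(α)}(F ⊗ K) + R` over `K[x]` to one over `k[x]`.  Results:

* `isIsolated_of_isIsolated_map` — **isolation goes DOWN**; with PR-12f's `isIsolated_map`: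
  **`isIsolated_map_iff : IsIsolated q (F ⊗ K) ↔ IsIsolated q F`** — the Scope add-on's ISOLATED
  predicate is GEOMETRIC (the same over the state's field, over any extension, over `K̄`); consequently
  NON-isolation witnesses found over an extension (an `𝔽₄`-rational curve of `q`-fold points, a
  `K′⟦t⟧`-branch with `K′ ⊋ K`) certify non-isolation over the state's own field
  (`not_isIsolated_of_not_isIsolated_map`).

Nothing here proves resolution of singularities in dimension ≥ 4 / characteristic `p`; counted 0;
AI work, weaker than expert review.
bears_on: LADDER-RESOLUTION:D157-DOOR2 (res-dim4-pi · PR-12g). Supports stmt-ResolutionOfSingularities-16155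
(helper).
-/

set_option linter.dupNamespace false

noncomputable section

namespace Summit.ResolutionOfSingularities.ResolutionOfSingularities.Theorems.PIDim4

namespace IsolationDescent

open MvPolynomial
open Literature.AlgebraicGeometry.Resolution
open Literature.RingTheory.MvPolynomial (mem_idealOfVars_iff_constantCoeff_eq_zero
  monomial_mem_idealOfVars_pow_of_le)

variable {k K : Type} [Field k] [Field K] (f : k →+* K)

/-! ## 1. A `k`-linear retraction of `f`, applied coefficientwise -/

/-- A homomorphism of fields has an additive retraction that is linear over the small field:
`φ (f a) = a` and `φ (x · f a) = φ x · a`. [folklore] -/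
theorem exists_retraction :
    ∃ φ : K →+ k, (∀ a, φ (f a) = a) ∧ ∀ x a, φ (x * f a) = φ x * a := by
  letI : Algebra k K := f.toAlgebra
  have hker : LinearMap.ker (Algebra.linearMap k K) = ⊥ :=
    LinearMap.ker_eq_bot.mpr fun x y hxy => f.injective hxy
  obtain ⟨π, hπ⟩ := LinearMap.exists_leftInverse_of_injective (Algebra.linearMap k K) hker
  have hπf : ∀ a, π (f a) = a := fun a => LinearMap.congr_fun hπ a
  refine ⟨π.toAddMonoidHom, hπf, fun x a => ?_⟩
  show π (x * f a) = π x * a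
  have : x * f a = a • x := by rw [Algebra.smul_def, mul_comm]; rfl
  rw [this, map_smul, smul_eq_mul, mul_comm]

/-- Coefficients of the coefficientwise image. [folklore] -/
theorem coeff_cmap (φ : K →+ k) (G : MvPolynomial (Fin 4) K) (m : Fin 4 →₀ ℕ) :
    coeff m (AddMonoidAlgebra.map φ G : MvPolynomial (Fin 4) k) = φ (coeff m G) :=
  MvPolynomial.coeff_addMonoidAlgebraMap φ G m

/-- The coefficientwise retraction fixes polynomials coming from `k`. [folklore] -/
theorem cmap_map {φ : K →+ k} (hφ : ∀ a, φ (f a) = a) (H : MvPolynomial (Fin 4) k) :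
    (AddMonoidAlgebra.map φ (MvPolynomial.map f H) : MvPolynomial (Fin 4) k) = H := by
  ext m
  rw [coeff_cmap, coeff_map, hφ]

/-- … and is `k[x]`-linear on products with polynomials coming from `k`. [folklore] -/
theorem cmap_mul_map {φ : K →+ k} (hφ : ∀ x a, φ (x * f a) = φ x * a) (G : MvPolynomial (Fin 4) K)
    (H : MvPolynomial (Fin 4) k) :
    (AddMonoidAlgebra.map φ (G * MvPolynomial.map f H) : MvPolynomial (Fin 4) k) =
      (AddMonoidAlgebra.map φ G : MvPolynomial (Fin 4) k) * H := by
  classical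
  ext m
  rw [coeff_cmap, coeff_mul, coeff_mul, map_sum]
  refine Finset.sum_congr rfl fun x _ => ?_
  rw [coeff_map, hφ, coeff_cmap]

/-- … and preserves `𝔪₀ⁿ` (coefficients below degree `n` stay zero). [folklore] -/
theorem cmap_mem_originIdeal_pow (φ : K →+ k) {n : ℕ} {G : MvPolynomial (Fin 4) K}
    (hG : G ∈ originIdeal K ^ n) :
    (AddMonoidAlgebra.map φ G : MvPolynomial (Fin 4) k) ∈ originIdeal k ^ n := by
  rw [IsolationCert.mem_originIdeal_pow_iff] at hG ⊢
  intro d hd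
  rw [coeff_cmap, hG d hd, map_zero]

/-- … and maps `J_q⁺(F ⊗ K)` into `J_q⁺(F)`. [folklore] -/
theorem cmap_mem_singLocusIdeal {φ : K →+ k} (hφ : ∀ x a, φ (x * f a) = φ x * a) (q : ℕ)
    (F : MvPolynomial (Fin 4) k) {G : MvPolynomial (Fin 4) K}
    (hG : G ∈ singLocusIdeal q (MvPolynomial.map f F)) :
    (AddMonoidAlgebra.map φ G : MvPolynomial (Fin 4) k) ∈ singLocusIdeal q F := by
  classical
  unfold singLocusIdeal at hG
  rw [Ideal.span, Submodule.mem_span_set] at hG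
  obtain ⟨c, hc, rfl⟩ := hG
  rw [Finsupp.sum, AddMonoidAlgebra.map_sum]
  refine Ideal.sum_mem _ fun H hH => ?_
  obtain ⟨α, h0, hq, hHα⟩ := hc (Finset.mem_coe.mpr hH)
  rw [smul_eq_mul, hHα, IsolationConverse.hasseDeriv_map, cmap_mul_map f hφ]
  exact Ideal.mul_mem_left _ _ (Ideal.subset_span ⟨α, h0, hq, rfl⟩)

/-! ## 2. Isolation goes down -/

/-- `J_q⁺(F) ≤ 𝔪₀(k)` descends from `J_q⁺(F ⊗ K) ≤ 𝔪₀(K)` (constant terms). [folklore] -/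
theorem singLocusIdeal_le_originIdeal_of_map {q : ℕ} {F : MvPolynomial (Fin 4) k}
    (h : singLocusIdeal q (MvPolynomial.map f F) ≤ originIdeal K) :
    singLocusIdeal q F ≤ originIdeal k := by
  unfold singLocusIdeal
  rw [Ideal.span_le]
  rintro _ ⟨α, h0, hq, rfl⟩
  have hK : MvPolynomial.map f (hasseDeriv α F) ∈ originIdeal K := by
    apply h
    rw [← IsolationConverse.hasseDeriv_map]
    exact Ideal.subset_span ⟨α, h0, hq, rfl⟩
  rw [SetLike.mem_coe, IsolationCert.originIdeal_eq_idealOfVars,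
    mem_idealOfVars_iff_constantCoeff_eq_zero]
  rw [IsolationCert.originIdeal_eq_idealOfVars, mem_idealOfVars_iff_constantCoeff_eq_zero,
    constantCoeff_map] at hK
  exact f.injective (by rw [hK, map_zero])

/-- **The certificate descends**: `𝔪₀(K)ᴺ ≤ J_q⁺(F ⊗ K) + 𝔪₀(K)ᴺ⁺¹` implies
`𝔪₀(k)ᴺ ≤ J_q⁺(F) + 𝔪₀(k)ᴺ⁺¹`. [folklore] -/
theorem certificate_of_certificate_map {q : ℕ} {F : MvPolynomial (Fin 4) k} {N : ℕ}
    (h : originIdeal K ^ N ≤ singLocusIdeal q (MvPolynomial.map f F) ⊔ originIdeal K ^ (N + 1)) :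
    originIdeal k ^ N ≤ singLocusIdeal q F ⊔ originIdeal k ^ (N + 1) := by
  obtain ⟨φ, hφ1, hφ2⟩ := exists_retraction f
  refine IsolationCert.pow_le_sup_pow_succ_of_forall_monomial fun γ hγ => ?_
  have hγK : (monomial γ (1 : K)) ∈ originIdeal K ^ N := by
    rw [IsolationCert.originIdeal_eq_idealOfVars]
    exact monomial_mem_idealOfVars_pow_of_le (le_of_eq hγ.symm) 1
  obtain ⟨a, ha, b, hb, hab⟩ := Submodule.mem_sup.mp (h hγK)
  have hmon : (AddMonoidAlgebra.map φ (monomial γ (1 : K)) : MvPolynomial (Fin 4) k) =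
      monomial γ 1 := by
    have : (monomial γ (1 : K)) = MvPolynomial.map f (monomial γ 1) := by
      rw [MvPolynomial.map_monomial, f.map_one]
    rw [this, cmap_map f hφ1]
  rw [← hmon, ← hab, AddMonoidAlgebra.map_add]
  exact Submodule.add_mem_sup (cmap_mem_singLocusIdeal f hφ2 q F ha)
    (cmap_mem_originIdeal_pow φ hb)

/-- **Isolation goes DOWN** along any homomorphism of fields. [folklore] -/
theorem isIsolated_of_isIsolated_map {q : ℕ} {F : MvPolynomial (Fin 4) k}
    (h : IsIsolated q (MvPolynomial.map f F)) : IsIsolated q F := by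
  obtain ⟨N, hN⟩ := IsolationConverse.exists_certificate_of_isIsolated h
  exact IsolationCert.isIsolated_of_pow_le_sup_pow_succ (singLocusIdeal_le_originIdeal_of_map f h.1)
    (certificate_of_certificate_map f hN)

/-- **The Scope predicate `IsIsolated` is geometric**: invariant under extension of the coefficient
field, in both directions. [folklore] -/
theorem isIsolated_map_iff {q : ℕ} {F : MvPolynomial (Fin 4) k} :
    IsIsolated q (MvPolynomial.map f F) ↔ IsIsolated q F :=
  ⟨isIsolated_of_isIsolated_map f, IsolationConverse.isIsolated_map f⟩

/-- Hence a NON-isolation witness over an extension field certifies non-isolation over the state's own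
field. [folklore] -/
theorem not_isIsolated_of_not_isIsolated_map {q : ℕ} {F : MvPolynomial (Fin 4) k}
    (h : ¬ IsIsolated q (MvPolynomial.map f F)) : ¬ IsIsolated q F :=
  fun hF => h (IsolationConverse.isIsolated_map f hF)

end IsolationDescent

end Summit.ResolutionOfSingularities.ResolutionOfSingularities.Theorems.PIDim4

end
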